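import Mathlib
import Summits.NavierStokesRegularity.NavierStokesRegularity.Theses.ClockStretchingLaw
import Summits.NavierStokesRegularity.NavierStokesRegularity.Theorems.ClockStretchingLawSmallStrainRung
import Summits.NavierStokesRegularity.NavierStokesRegularity.Theorems.SymmetryModuliCountSymmetricLiouvilleSmallAtMinusInfinity
import Literature.Analysis.FluidPDE.TypeIAncientMild
import Literature.Analysis.FluidPDE.CurlFreeLiouville
import HarnessLib

/-!
# Route ClockStretchingLaw, crux `ClockCeiling` (stmt-NavierStokesRegularity-10570) — the sharp
# far-past stretching rung

Portrait clause for the Type-I Liouville node to which the crux `ClockCeiling` is kernel-checked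
equivalent (`Theorems.clockCeiling_iff_typeIAncientLiouville`): **every nonzero Type-I KNSS-mild
ancient field must stretch its own vorticity at the full gauge rate `1` in the far past.**

Precisely (`farPastStretchingRung`): if `u ∈ A_C` (`IsTypeIAncientMild C u`: jointly smooth on
`(−∞,0) × ℝ³`, divergence-free, Oseen-mild between all pairs `s < t < 0`, `‖u(t,x)‖ ≤ C/√(−t)`)
and for some `T ≤ 0` and some `θ < 1` the gauge stretching rate along the vorticity direction
`ξ = ω/|ω|` obeys `(−t) ⟪∇u(t,x) ξ, ξ⟫ ≤ θ` at every point `(t, x)` with `t < T` and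
`ω(t,x) ≠ 0`, then `u ≡ 0` on the whole past `t < 0`.

This upgrades the route's support item `SmallStrainRung` (stmt-NavierStokesRegularity-10574,
`(−t)‖∇u(t)‖ ≤ ½` for ALL `t < 0`) in the three directions its card announced ("any constant `< 1`
works"): threshold `½ ↦ 1⁻`; operator norm of the whole gradient `↦` the stretching rate along the
vorticity direction only (wherever `ω ≠ 0`); all times `↦` the far past `t < T` only. The
constant `1` is the natural one of the maximum-principle method: `‖ω(s)‖_∞ ≤ K₀(C)/(−s)` and
`‖ω(t)‖_∞ ≤ ‖ω(s)‖_∞ ((−s)/(−t))^θ` decay to `0` as `s → −∞` exactly when `θ < 1`; at a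
vorticity maximum of a steady Leray profile the rate is `≥ 1`.

## Proof

Three tree engines glued.
* The backward time shift `v(t) = u(t + T)` is again in `A_C`
  (`IsTypeIAncientMild.comp_sub_right`), and since `−t ≤ −(t+T)` the hypothesis gives the
  stretching-certificate inequality of route `SymmetryModuliCount` for the constant weight `h ≡ 1`
  with `δ = 1 − max θ 0 > 0`, `A = 0`; hence `curl v ≡ 0` (`stretchCert_curl_eq_zero`, the weighted
  vorticity maximum principle with the class-uniform KNSS gauge gradient bound).
* Bounded curl- and divergence-free `C²` slices are constant
  (`eq_of_curl_eq_zero_of_isDivFree_of_bounded`, KNSS 2009 Lemma 3.1) and the Oseen gauge kills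
  slice-constant elements (`IsTypeIAncientMild.eq_zero_of_slice_const`, KNSS 2009 Remark 6.1):
  `v ≡ 0`, i.e. `u ≡ 0` before `T`.
* Forward uniqueness of bounded Oseen-mild solutions from a vanishing slice
  (`vanishes_of_vanishes_before`, `oseenMild_bounded_unique`) propagates `u ≡ 0` to all `t < 0`.

## References

* G. Koch, N. Nadirashvili, G. Seregin, V. Šverák, *Liouville theorems for the Navier–Stokes
  equations and applications*, Acta Math. 203 (2009) 83–105, Lemma 3.1, Prop. 4.1, Remark 6.1
  (arXiv:0709.3599). [KochNadirashviliSereginSverak2009]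
* P. Constantin, C. Fefferman, Indiana Univ. Math. J. 42 (1993) 775–789, §1 (the stretching rate
  `α = ⟪Sξ, ξ⟫`). [ConstantinFefferman1993]
-/

noncomputable section

-- the summit and its single sub-problem share the name (CONVENTIONS §1), as in every Theorems file
set_option linter.dupNamespace false

open Set Function Filter
open scoped RealInnerProductSpace Laplacian ContDiff Topology

namespace Summit.NavierStokesRegularity.NavierStokesRegularity.Theorems

open Literature.Analysis Literature.Analysis.FluidPDE
open Summit.NavierStokesRegularity.NavierStokesRegularity.Theorems.SymmetryModuliCountSymmetricLiouville

/-- **The sharp rung inequality for the constant weight.** If `0 < -s`, `-s ≤ -r`,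
`(-r) * a ≤ θ` with `0 ≤ θ` and `0 ≤ F`, then
`((−s)(a − F) − 1 + (1 − θ)) · 1 ≤ (−s)(0 + 0 − 0)`: the constant weight `h ≡ 1` satisfies the
stretching-certificate inequality with `δ = 1 − θ` as soon as the stretching rate `a` obeys
`(−r) a ≤ θ` at an EARLIER gauge time `r ≤ s` shifted into the past. [folklore] -/
theorem farPastStretchingRung_cert_ineq {s r a θ F : ℝ} (hs : 0 < -s) (hsr : -s ≤ -r)
    (ha : (-r) * a ≤ θ) (hθ : 0 ≤ θ) (hF : 0 ≤ F) :
    ((-s) * (a - F) - 1 + (1 - θ)) * (1 : ℝ) ≤ (-s) * ((0 : ℝ) + 0 - 0) := by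
  have hsa : (-s) * a ≤ θ := by
    rcases le_or_gt 0 a with ha0 | ha0
    · exact (mul_le_mul_of_nonneg_right hsr ha0).trans ha
    · have : (-s) * a ≤ 0 := mul_nonpos_of_nonneg_of_nonpos hs.le ha0.le
      linarith
  nlinarith [mul_nonneg hs.le hF]

/-- **Far-past stretching rung ⇒ vanishing before `T`.** If `u ∈ A_C` and, for some `T ≤ 0` and
`θ < 1`, `(−t)⟪∇u(t,x) ξ, ξ⟫ ≤ θ` (`ξ` the vorticity direction) wherever `t < T` and
`curl u(t,x) ≠ 0`, then `u(t, ·) ≡ 0` for every `t < T`: the backward shift `u(· + T) ∈ A_C`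
carries the constant stretching certificate `h ≡ 1`, `δ = 1 − max θ 0`, so its curl vanishes
(`stretchCert_curl_eq_zero`), its slices are constant (KNSS 2009 Lemma 3.1) and the gauge kills
them (KNSS 2009 Remark 6.1). [cite: KochNadirashviliSereginSverak2009, Lemma 3.1 and Remark 6.1 (arXiv:0709.3599)] -/
theorem farPastStretchingRung_vanishes_before {C : ℝ}
    {u : ℝ → EuclideanSpace ℝ (Fin 3) → EuclideanSpace ℝ (Fin 3)} (hu : IsTypeIAncientMild C u)
    {T θ : ℝ} (hT : T ≤ 0) (hθ : θ < 1)
    (hst : ∀ t < T, ∀ x, curl (u t) x ≠ 0 →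
      (-t) * ⟪fderiv ℝ (u t) x (vorticityDirection (curl (u t)) x),
        vorticityDirection (curl (u t)) x⟫ ≤ θ) :
    ∀ t < T, ∀ x, u t x = 0 := by
  -- WLOG `0 ≤ θ`
  set θ' : ℝ := max θ 0 with hθ'
  have hθ'0 : 0 ≤ θ' := le_max_right _ _
  have hθ'1 : θ' < 1 := max_lt hθ one_pos
  -- the backward shift `v t = u (t + T)` is again in the class
  set v : ℝ → EuclideanSpace ℝ (Fin 3) → EuclideanSpace ℝ (Fin 3) := fun t => u (t - -T) with hvdef
  have hv : IsTypeIAncientMild C v := hu.comp_sub_right (by linarith)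
  -- the constant certificate `h ≡ 1`, `δ = 1 - θ'`, `A = 0`
  have hh : IsSmoothSpaceTimeOn (Iio 0) (fun (_ : ℝ) (_ : EuclideanSpace ℝ (Fin 3)) => (1 : ℝ)) :=
    contDiffOn_const
  have hh1 : ∀ s < (0 : ℝ), ∀ (y : EuclideanSpace ℝ (Fin 3)),
      1 ≤ (fun (_ : ℝ) (_ : EuclideanSpace ℝ (Fin 3)) => (1 : ℝ)) s y := fun _ _ _ => le_rfl
  have hgrad1 : ∀ s < (0 : ℝ), ∀ (y : EuclideanSpace ℝ (Fin 3)),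
      ‖fderiv ℝ ((fun (_ : ℝ) (_ : EuclideanSpace ℝ (Fin 3)) => (1 : ℝ)) s) y‖ ≤
        0 * (1 / Real.sqrt (-s) + ‖y‖ / (-s)) *
          (fun (_ : ℝ) (_ : EuclideanSpace ℝ (Fin 3)) => (1 : ℝ)) s y := by
    intro s _ y
    simp
  have hcert : ∀ s < (0 : ℝ), ∀ (y : EuclideanSpace ℝ (Fin 3)), curl (v s) y ≠ 0 →
      ((-s) * (⟪fderiv ℝ (v s) y (vorticityDirection (curl (v s)) y),
          vorticityDirection (curl (v s)) y⟫
          - frobeniusNormSq (fderiv ℝ (vorticityDirection (curl (v s))) y)) - 1 + (1 - θ')) *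
          (fun (_ : ℝ) (_ : EuclideanSpace ℝ (Fin 3)) => (1 : ℝ)) s y ≤
        (-s) * (timeDeriv (fun (_ : ℝ) (_ : EuclideanSpace ℝ (Fin 3)) => (1 : ℝ)) s y +
          fderiv ℝ ((fun (_ : ℝ) (_ : EuclideanSpace ℝ (Fin 3)) => (1 : ℝ)) s) y (v s y) -
          (Δ ((fun (_ : ℝ) (_ : EuclideanSpace ℝ (Fin 3)) => (1 : ℝ)) s)) y) := by
    intro s hs y hω
    have htd : timeDeriv (fun (_ : ℝ) (_ : EuclideanSpace ℝ (Fin 3)) => (1 : ℝ)) s y = 0 := by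
      simp [timeDeriv]
    have hfd : fderiv ℝ ((fun (_ : ℝ) (_ : EuclideanSpace ℝ (Fin 3)) => (1 : ℝ)) s) y (v s y) = 0 := by
      simp
    have hΔ : (Δ ((fun (_ : ℝ) (_ : EuclideanSpace ℝ (Fin 3)) => (1 : ℝ)) s)) y = 0 :=
      laplacian_const_eq_zero (1 : ℝ) y
    rw [htd, hfd, hΔ]
    -- the hypothesis at the earlier time `s + T < T`
    have hsT : s - -T < T := by linarith
    have hω' : curl (u (s - -T)) y ≠ 0 := hω
    have key := hst (s - -T) hsT y hω'
    have key' : (-(s - -T)) * ⟪fderiv ℝ (v s) y (vorticityDirection (curl (v s)) y),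
        vorticityDirection (curl (v s)) y⟫ ≤ θ' := key.trans (le_max_left _ _)
    exact farPastStretchingRung_cert_ineq (neg_pos.2 hs) (by linarith) key' hθ'0
      (frobeniusNormSq_nonneg _)
  have hω : ∀ s < 0, ∀ y, curl (v s) y = 0 := fun s hs y =>
    stretchCert_curl_eq_zero hv hh hh1 (by linarith : (0 : ℝ) < 1 - θ') hgrad1 hcert hs y
  have hub : ∀ s < 0, ∀ y, v s y = v s 0 := fun s hs y =>
    eq_of_curl_eq_zero_of_isDivFree_of_bounded ((hv.contDiff_slice hs).of_le (by norm_cast))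
      (hω s hs) (hv.isDivFree hs) (fun z => hv.norm_le hs z) y 0
  have hv0 : ∀ s < 0, ∀ y, v s y = 0 := fun s hs y => hv.eq_zero_of_slice_const hub hs y
  intro t ht x
  have key := hv0 (t - T) (by linarith) x
  simpa [hvdef] using key

/-- **The sharp far-past stretching rung (portrait clause of the Type-I Liouville node / crux
`ClockCeiling`).** For every `u ∈ A_C`: if for some `T ≤ 0` and some `θ < 1` the gauge stretching
rate along the vorticity direction obeys `(−t)⟪∇u(t,x) ξ(t,x), ξ(t,x)⟫ ≤ θ` at every `(t, x)` with
`t < T` and `curl u(t,x) ≠ 0`, then `u ≡ 0` on `t < 0`. Equivalently, every NONZERO Type-I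
KNSS-mild ancient field has `limsup_{t → −∞} sup_{ω(t,x) ≠ 0} (−t)⟪S ξ, ξ⟫ ≥ 1`.
(`farPastStretchingRung_vanishes_before` + forward uniqueness `vanishes_of_vanishes_before`.) [cite: KochNadirashviliSereginSverak2009, Lemma 3.1, Prop. 4.1, Remark 6.1 (arXiv:0709.3599)] -/
theorem farPastStretchingRung {C : ℝ}
    {u : ℝ → EuclideanSpace ℝ (Fin 3) → EuclideanSpace ℝ (Fin 3)} (hu : IsTypeIAncientMild C u)
    {T θ : ℝ} (hT : T ≤ 0) (hθ : θ < 1)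
    (hst : ∀ t < T, ∀ x, curl (u t) x ≠ 0 →
      (-t) * ⟪fderiv ℝ (u t) x (vorticityDirection (curl (u t)) x),
        vorticityDirection (curl (u t)) x⟫ ≤ θ) :
    ∀ t < 0, ∀ x, u t x = 0 := by
  have hz : ∀ t < T - 1, ∀ x, u t x = 0 := fun t ht x =>
    farPastStretchingRung_vanishes_before hu hT hθ hst t (by linarith) x
  exact vanishes_of_vanishes_before hu (by linarith : T - 1 < 0) hz

/-- **Stub `stub_farPastStretchingRung` (crux stmt-NavierStokesRegularity-10570, line `registered`,
portrait clause).** In the vocabulary of the route's class (the hypotheses of `ClockCeiling` /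
`SmallStrainRung` minus the local energies, i.e. `IsTypeIAncientMild` with the Oseen–Koch–Tataru
kernel written out through `UnboundedOperators.heatKernel`): a smooth divergence-free KNSS-mild
ancient field with `|u| ≤ C/√(−t)` whose gauge strain obeys `(−t)‖∇u(t)‖ ≤ θ` for some `θ < 1`
and all `t < T` (some `T ≤ 0`) vanishes identically — the sharp form of `SmallStrainRung`
(`θ = ½`, all `t < 0`). [cite: KochNadirashviliSereginSverak2009, Lemma 3.1, Prop. 4.1, Remark 6.1 (arXiv:0709.3599)] -/
theorem stub_farPastStretchingRung :
    ∀ (C T θ : ℝ) (u : ℝ → EuclideanSpace ℝ (Fin 3) → EuclideanSpace ℝ (Fin 3)), T ≤ 0 → θ < 1 →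
      (ContDiffOn ℝ (⊤ : ℕ∞) (Function.uncurry u) (Set.Iio 0 ×ˢ Set.univ) ∧
      (∀ t < 0, Literature.Analysis.FluidPDE.VectorCalculus.IsDivFree (u t)) ∧
      (∀ s t : ℝ, s < t → t < 0 → ∀ x, u t x =
        Literature.Analysis.FluidPDE.heatFlow (u s) (t - s) x -
          ∫ τ in Set.Ioo s t, ∫ y,
            ((-(inner ℝ (x - y) (u τ y) / (2 * (t - τ)) *
                Literature.Analysis.UnboundedOperators.heatKernel (t - τ) (x - y))) • u τ y +
              (∫ σ in Set.Ioi (t - τ),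
                  Literature.Analysis.UnboundedOperators.heatKernel σ (x - y) / (4 * σ ^ 2)) •
                (inner ℝ (x - y) (u τ y) • u τ y + inner ℝ (u τ y) (u τ y) • (x - y) +
                  inner ℝ (x - y) (u τ y) • u τ y) -
              ((∫ σ in Set.Ioi (t - τ),
                  Literature.Analysis.UnboundedOperators.heatKernel σ (x - y) / (8 * σ ^ 3)) *
                (inner ℝ (x - y) (u τ y) * inner ℝ (x - y) (u τ y))) • (x - y))) ∧
      Literature.Analysis.FluidPDE.HasTypeITimeDecay C u) →
      (∀ t < T, ∀ x, (-t) * ‖fderiv ℝ (u t) x‖ ≤ θ) → ∀ t < 0, ∀ x, u t x = 0 := by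
  intro C T θ u hT hθ hu hgrad
  have hu' : IsTypeIAncientMild C u := smallStrainRung_isTypeIAncientMild hu
  refine farPastStretchingRung hu' hT hθ fun t ht x hω => ?_
  have hξ : ‖vorticityDirection (curl (u t)) x‖ ≤ 1 :=
    (norm_vorticityDirection (curl (u t)) hω).le
  set L := fderiv ℝ (u t) x
  set ξ := vorticityDirection (curl (u t)) x
  have h1 : ⟪L ξ, ξ⟫ ≤ ‖L‖ := by
    calc ⟪L ξ, ξ⟫ ≤ ‖L ξ‖ * ‖ξ‖ := real_inner_le_norm _ _
      _ ≤ ‖L‖ * ‖ξ‖ * ‖ξ‖ := by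
          exact mul_le_mul_of_nonneg_right (L.le_opNorm ξ) (norm_nonneg ξ)
      _ ≤ ‖L‖ := by
          have h0 : 0 ≤ ‖L‖ := norm_nonneg L
          have h0' : 0 ≤ ‖ξ‖ := norm_nonneg ξ
          nlinarith [mul_le_mul_of_nonneg_left hξ h0, mul_nonneg h0 h0',
            mul_le_mul_of_nonneg_left hξ (mul_nonneg h0 h0')]
  have ht0 : 0 ≤ -t := by linarith
  exact (mul_le_mul_of_nonneg_left h1 ht0).trans (hgrad t ht x)

end Summit.NavierStokesRegularity.NavierStokesRegularity.Theorems

end
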